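import Literature.NumberTheory.Automorphic.AnisotropicUnitaryGroupCompactLocal
import Literature.NumberTheory.Automorphic.Liu2021.LemD1DataOfPlace
import HarnessLib

/-!
# `U(H)(F_v)` is compact at the finite places where the local standing hermitian space is ANISOTROPIC — the bridge from
# [Liu2021, Lem. D.1 (4)]'s «`V ⊗ F_v` is (an)isotropic» (★ `LemD1.IsIsotropic (LemD1OfPlace.standingData … v …)`) to the
# one-place model `U(σ_w, J_w)(E_w)`

Topic `NumberTheory/Automorphic`; namespace `Literature.NumberTheory.Automorphic.UnitaryGroup`.  THEOREMS ONLY (kernel lane): no `def`, no named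
fact, no instance, no notation, no `sorry`.

The tree reads «the hermitian space `(E_v^N, J ⊗ 1)` is isotropic at `v`» on the LOCAL standing data of [Liu2021, App. D §D.1] (★
`LemD1OfPlace.standingData E v c N J …` over `E_v = Π_{w ∣ v} E_w` with `c ⊗ 1`, `LemD1.IsIsotropic`: «some `x ≠ 0` has `(x, x)_V = 0`») — the
currency of ★ `RemD5CompanionParity.even_ncard_not_isIsotropic_iff` (the parity of the number of ANISOTROPIC places of the hermitian plane of the P5
letters) — while ★ `AnisotropicUnitaryGroupCompactLocal` reads anisotropy on the ONE-PLACE model `(E_w^N, J_w)`, `σ_w = galAdicCompletionMap c hw`,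
at a non-split `v` (`w ∣ v`, `c • w = w`).  At a non-split place `w` is the only place above `v` (★ `PlacesOver.eq_of_smul_eq`), and the two
readings agree:

* `standingData_form_apply_eq` — the `w`-component of the standing pairing `(X, Y)_V ∈ E_v` is the one-place pairing of the `w`-components:
  `((X, Y)_V)_w = h_{σ_w, J_w}(X_w, Y_w)` (★ `conjLocal_apply`, ★ `localForm_map_eval`).
* `isIsotropic_standingData_iff_placeForm` — «`V ⊗ F_v` isotropic» ⟺ «some `x ≠ 0` in `E_w^N` has `h_{σ_w, J_w}(x, x) = 0`».
* **`anisotropic_placeForm_of_not_isIsotropic`** — `¬ IsIsotropic` ⇒ the one-place pairing is anisotropic (the hypothesis `hanis` of ★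
  `compactSpace_local_of_anisotropic`).
* **`compactSpace_local_of_not_isIsotropic`**, **`compactSpace_cmDatum_local_of_not_isIsotropic`** — at a non-split finite place where the local
  standing hermitian space is ANISOTROPIC the local group `U(J)(F_v)` (resp. `(cmDatum L N H).Local v`) is COMPACT.

USE (cell hodgecm-mathlib, P5, director s465): with `J = diag(dV)` the P5 hermitian plane, the set `T` of such places is the one counted by ★
`RemD5CompanionParity` (non-empty for `[L⁺:ℚ]` even); at `v ∈ T` the inner form `U(H)` is the compact unitary group in two variables — Rogawski's
«`v ∈ S`» [Rogawski1990, §14.2].  HC_CM is proved only modulo the printed citations until rung 0 closes.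

## References
* [Liu2021] Y. Liu, *Fourier–Jacobi cycles and arithmetic relative trace formula*, Camb. J. Math. 9 (2021), App. D §D.1, Lemma D.1 (4) (arXiv:2102.11518
  p. 56).
* [PlatonovRapinchuk1994] V. Platonov, A. Rapinchuk, *Algebraic Groups and Number Theory* (1994), §3.1 Thm. 3.1, §5.1.
* [Rogawski1990] J. Rogawski, Ann. of Math. Stud. 123 (1990), §14.2 p. 232.
-/

noncomputable section

open scoped Matrix MatrixGroups
open NumberField IsDedekindDomain

namespace Literature.NumberTheory.Automorphic

namespace UnitaryGroup

open Literature.NumberTheory.Automorphic.Liu2021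
open Literature.RepresentationTheory.Liu2021 (OscillatorStandingData)

variable {F E : Type} [Field F] [NumberField F] [Field E] [NumberField E] [Algebra F E] [Algebra.IsQuadraticExtension F E]
  (c : E ≃ₐ[F] E) (hc : c ≠ 1) (N : ℕ) (J : Matrix (Fin N) (Fin N) E) (v : HeightOneSpectrum (𝓞 F)) (w : PlacesOver E v)
  (hw : c • w.1 = w.1) {δ : E} (hcδ : c δ = -δ) (hδ : δ ≠ 0) (hN : 2 ≤ N) (hJh : (J.map c)ᵀ = J) (hJdet : J.det ≠ 0)

include hc hw

/-- At a non-split place, the twisted component `σ (y_{c⁻¹ w′})` read at ANY place `w′ ∣ v` with `c • w′ = w` is `σ_w (y_w)` (there is only one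
place above `v`). [cite: PlatonovRapinchuk1994, §5.1] -/
theorem galAdicCompletionMap_apply_eq_of_smul_eq (w₁ : PlacesOver E v) (h₁ : c • w₁.1 = w.1) (y : LocalRing E v) :
    galAdicCompletionMap (L := E) c h₁ (y w₁) = galAdicCompletionMap (L := E) c hw (y w) := by
  obtain rfl : w₁ = w := PlacesOver.eq_of_smul_eq c hc w hw w₁
  rfl

/-- `(c ⊗ 1) y` read at `w` is `σ_w (y_w)` at a non-split place. [cite: PlatonovRapinchuk1994, §5.1] -/
theorem conjLocal_apply_eq_of_smul_eq (y : LocalRing E v) :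
    conjLocal E c v y w = galAdicCompletionMap (L := E) c hw (y w) := by
  rw [conjLocal_apply]
  exact galAdicCompletionMap_apply_eq_of_smul_eq c hc v w hw ⟨c⁻¹ • w.1, under_inv_smul_eq c w⟩ (smul_inv_smul c w.1) y

omit [NumberField F] [Algebra.IsQuadraticExtension F E] hc hw in
/-- The `(i, j)` entry of the local Gram matrix `J ⊗ 1 ∈ M_N(E_v)` read at `w` is `(J_w)_{ij}`. [cite: PlatonovRapinchuk1994, §5.1] -/
theorem localGram_apply_apply (i j : Fin N) :
    ((adelicForm E N J).map (adeleToLocal E v)) i j w = placeForm J w.1 i j := by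
  have h := congr_fun (congr_fun (localForm_map_eval E N J v w) i) j
  rw [Matrix.map_apply] at h
  exact h

/-- **The `w`-component of the standing pairing is the one-place pairing**: for `X, Y ∈ E_v^N`,
`((X, Y)_V)_w = h_{σ_w, J_w}(X_w, Y_w)`. [cite: Liu2021, App. D §D.1, Lemma D.1 (4)] [cite: PlatonovRapinchuk1994, §5.1] -/
theorem standingData_form_apply_eq (X Y : Fin N → LocalRing E v) :
    (LemD1OfPlace.standingData E v c N J hcδ hδ hN hJh hJdet).form X Y w =
      UnitaryGroup.hermForm (galAdicCompletionMap (L := E) c hw) (placeForm J w.1) (fun i => X i w) (fun i => Y i w) := by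
  rw [OscillatorStandingData.form, Literature.AlgebraicGeometry.ShimuraVarieties.hermForm,
    Literature.NumberTheory.Automorphic.UnitaryGroup.hermForm_apply]
  simp only [dotProduct, Matrix.mulVec, Finset.sum_apply, Pi.mul_apply, Function.comp_apply,
    OscillatorStandingData.σ_apply, LemD1OfPlace.standingData_conj_apply, LemD1OfPlace.standingData_gram,
    conjLocal_apply_eq_of_smul_eq c hc v w hw, localGram_apply_apply]

/-- **«`V ⊗ F_v` is isotropic» ⟺ «the one-place pairing has a non-zero isotropic vector»** at a non-split `v`.
[cite: Liu2021, App. D §D.1, Lemma D.1 (4)] -/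
theorem isIsotropic_standingData_iff_placeForm :
    LemD1.IsIsotropic (LemD1OfPlace.standingData E v c N J hcδ hδ hN hJh hJdet) ↔
      ∃ x : Fin N → w.1.adicCompletion E, x ≠ 0 ∧
        UnitaryGroup.hermForm (galAdicCompletionMap (L := E) c hw) (placeForm J w.1) x x = 0 := by
  constructor
  · rintro ⟨X, hX0, hX⟩
    refine ⟨fun i => X i w, ?_, ?_⟩
    · intro h0
      apply hX0
      funext i w'
      obtain rfl : w = w' := (PlacesOver.eq_of_smul_eq c hc w hw w').symm
      exact congr_fun h0 i
    · rw [← standingData_form_apply_eq c hc N J v w hw hcδ hδ hN hJh hJdet X X, hX, Pi.zero_apply]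
  · rintro ⟨x, hx0, hx⟩
    -- spread `x` over the (single) place above `v`
    let X : Fin N → LocalRing E v := fun i w' =>
      cast (congrArg (fun u : PlacesOver E v => u.1.adicCompletion E) (PlacesOver.eq_of_smul_eq c hc w hw w').symm) (x i)
    have hXw : ∀ i, X i w = x i := fun i => cast_eq _ _
    refine ⟨X, ?_, ?_⟩
    · intro h0
      apply hx0
      funext i
      rw [← hXw i, h0]
      rfl
    · funext w'
      obtain rfl : w = w' := (PlacesOver.eq_of_smul_eq c hc w hw w').symm
      rw [standingData_form_apply_eq c hc N J v w hw hcδ hδ hN hJh hJdet X X, Pi.zero_apply]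
      have h1 : (fun i => X i w) = x := funext hXw
      rw [h1, hx]

/-- **`¬ IsIsotropic` ⇒ the one-place pairing is ANISOTROPIC** (the hypothesis `hanis` of ★ `compactSpace_local_of_anisotropic`).
[cite: Liu2021, App. D §D.1, Lemma D.1 (4)] -/
theorem anisotropic_placeForm_of_not_isIsotropic
    (h : ¬ LemD1.IsIsotropic (LemD1OfPlace.standingData E v c N J hcδ hδ hN hJh hJdet)) :
    ∀ x : Fin N → w.1.adicCompletion E,
      UnitaryGroup.hermForm (galAdicCompletionMap (L := E) c hw) (placeForm J w.1) x x = 0 → x = 0 := by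
  intro x hx
  by_contra hx0
  exact h ((isIsotropic_standingData_iff_placeForm c hc N J v w hw hcδ hδ hN hJh hJdet).2 ⟨x, hx0, hx⟩)

/-- **`U(J)(F_v)` is COMPACT at a non-split finite place where the local standing hermitian space is anisotropic.**
[cite: PlatonovRapinchuk1994, §3.1 Thm. 3.1] [cite: Liu2021, App. D §D.1, Lemma D.1 (4)] [cite: Rogawski1990, §14.2 p. 232] -/
theorem compactSpace_local_of_not_isIsotropic
    (h : ¬ LemD1.IsIsotropic (LemD1OfPlace.standingData E v c N J hcδ hδ hN hJh hJdet)) :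
    CompactSpace («local» E c N J v) :=
  compactSpace_local_of_anisotropic c J v w hw hc (anisotropic_placeForm_of_not_isIsotropic c hc N J v w hw hcδ hδ hN hJh hJdet h)

omit hc hw in
/-- **CM packaging**: for a CM field `L`, `H ∈ M_N(L)` hermitian non-degenerate, `N ≥ 2`, a trace-zero `δ ≠ 0`, and a finite place `v` of `L⁺` NOT
split in `L` (`w ∣ v` fixed by complex conjugation) at which the local standing hermitian space `(L_v^N, H ⊗ 1)` is ANISOTROPIC, the local group
`(cmDatum L N H).Local v` is COMPACT. [cite: PlatonovRapinchuk1994, §3.1 Thm. 3.1] [cite: Liu2021, App. D §D.1, Lemma D.1 (4)]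
[cite: Rogawski1990, §14.2 p. 232] -/
theorem compactSpace_cmDatum_local_of_not_isIsotropic (L : Type) [Field L] [NumberField L] [IsCMField L] (N : ℕ)
    (H : Matrix (Fin N) (Fin N) L) (v : HeightOneSpectrum (𝓞 ↥(maximalRealSubfield L)))
    (w : PlacesOver L v) (hw : IsCMField.complexConj L • w.1 = w.1)
    {δ : L} (hcδ : IsCMField.complexConj L δ = -δ) (hδ : δ ≠ 0) (hN : 2 ≤ N)
    (hHh : (H.map (IsCMField.complexConj L))ᵀ = H) (hHdet : H.det ≠ 0)
    (h : ¬ LemD1.IsIsotropic (LemD1OfPlace.standingData L v (IsCMField.complexConj L) N H hcδ hδ hN hHh hHdet)) :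
    CompactSpace ((cmDatum L N H).Local v) :=
  compactSpace_local_of_not_isIsotropic (IsCMField.complexConj L) (IsCMField.complexConj_ne_one L) N H v w hw hcδ hδ hN hHh hHdet h

end UnitaryGroup

end Literature.NumberTheory.Automorphic

end
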